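import Mathlib

/-!
# Crux `TateFamilyKernel` (stmt-KontsevichZagierPeriods-9130), line `Sketch`: `stub_faceQuotient`

The face difference quotient of the lead's skeleton of the crux
`Summit.KontsevichZagierPeriods.KontsevichZagierPeriods.Theses.InverseLandau.TateFamilyKernel`:
for `τ ∈ ℚ[s]` positive on `[0,1]` and `N ∈ ℚ[s,ϖ]` (variables `X 0 = s`, `X 1 = ϖ`) there is a
real polynomial `Pol` with
`∫₀¹ N(s,ϖ)/(1 − ϖτ(s)) ds = ∫₀¹ N(s,1/τ(s))/(1 − ϖτ(s)) ds + Pol(ϖ)` whenever `1 − ϖτ ≠ 0` on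
`[0,1]`.

* Algebra (`FaceQuotient.exists_diffQuot`): `N(s,ϖ) − N(s,u) = (ϖ − u)·R(s,ϖ,u)` for some
  `R ∈ ℚ[s,ϖ,u]` (induction on `N`).
* Pointwise (`FaceQuotient.pointwise`): with `t = τ(s) ≠ 0`, `u = t⁻¹` and `1 − ϖt ≠ 0` one has
  `(ϖ − t⁻¹)/(1 − ϖt) = −t⁻¹`, so `N(s,ϖ)/(1−ϖt) = N(s,t⁻¹)/(1−ϖt) − t⁻¹R(s,ϖ,t⁻¹)`, and expanding
  `R` over its support the correction is `Σ_d g_d(s) ϖ^{d 1}` with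
  `g_d(s) = −coeff_d(R) s^{d 0} t^{−(d 2 + 1)}` continuous on `[0,1]`.
* Integration over `[0,1]`: `Pol = Σ_d C(∫₀¹ g_d) X^{d 1}`.

Mathlib only; no named fact, no new definition.
-/

noncomputable section

open MeasureTheory Set MvPolynomial

namespace Summit.KontsevichZagierPeriods.InverseLandau.TateFamilyKernel.Descent

namespace FaceQuotient

/-- **Difference quotient in the second variable.** For `N ∈ ℚ[s,ϖ]` there is `R ∈ ℚ[s,ϖ,u]` with
`N(s,ϖ) − N(s,u) = (ϖ − u)·R(s,ϖ,u)` at all real points. [folklore] -/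
theorem exists_diffQuot (N : MvPolynomial (Fin 2) ℚ) :
    ∃ R : MvPolynomial (Fin 3) ℚ, ∀ s ϖ u : ℝ,
      aeval (![s, ϖ] : Fin 2 → ℝ) N - aeval (![s, u] : Fin 2 → ℝ) N =
        (ϖ - u) * aeval (![s, ϖ, u] : Fin 3 → ℝ) R := by
  induction N using MvPolynomial.induction_on with
  | C a => exact ⟨0, fun s ϖ u => by simp⟩
  | add p q hp hq =>
    obtain ⟨Rp, hRp⟩ := hp
    obtain ⟨Rq, hRq⟩ := hq
    refine ⟨Rp + Rq, fun s ϖ u => ?_⟩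
    rw [map_add, map_add, map_add, add_sub_add_comm, hRp, hRq, mul_add]
  | mul_X p i hp =>
    obtain ⟨Rp, hRp⟩ := hp
    fin_cases i
    · refine ⟨X 0 * Rp, fun s ϖ u => ?_⟩
      have h := hRp s ϖ u
      simp only [map_mul, aeval_X, Fin.zero_eta, Fin.isValue, Matrix.cons_val_zero]
      linear_combination s * h
    · refine ⟨X 1 * Rp + rename ![0, 2] p, fun s ϖ u => ?_⟩
      have h := hRp s ϖ u
      have hf : (![s, ϖ, u] : Fin 3 → ℝ) ∘ (![0, 2] : Fin 2 → Fin 3) = ![s, u] := by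
        funext j
        fin_cases j <;> rfl
      have hr : aeval (![s, ϖ, u] : Fin 3 → ℝ) (rename ![0, 2] p) =
          aeval (![s, u] : Fin 2 → ℝ) p := by
        rw [aeval_rename, hf]
      simp only [map_mul, map_add, aeval_X, hr, Fin.mk_one, Fin.isValue, Matrix.cons_val_one,
        Matrix.cons_val_zero]
      linear_combination ϖ * h

/-- Real evaluation of a `ℚ`-polynomial in `n` variables is continuous. [folklore] -/
theorem continuous_aeval {n : ℕ} (P : MvPolynomial (Fin n) ℚ) :
    Continuous fun z : Fin n → ℝ => aeval z P := by
  have : (fun z : Fin n → ℝ => aeval z P) = fun z => eval z (map (algebraMap ℚ ℝ) P) := by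
    funext z
    rw [eval_map, aeval_def]
  rw [this]
  exact MvPolynomial.continuous_eval _

/-- **The pointwise face identity.** If `N(s,ϖ) − N(s,u) = (ϖ − u)R(s,ϖ,u)`, `t ≠ 0` and
`1 − ϖt ≠ 0`, then `N(s,ϖ)/(1−ϖt) = N(s,t⁻¹)/(1−ϖt) + Σ_{d ∈ supp R} g_d ϖ^{d 1}` with
`g_d = −coeff_d(R) s^{d 0} t^{−(d 2 + 1)}` (because `(ϖ − t⁻¹)/(1 − ϖt) = −t⁻¹`). [folklore] -/
theorem pointwise {N : MvPolynomial (Fin 2) ℚ} {R : MvPolynomial (Fin 3) ℚ}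
    (hR : ∀ s ϖ u : ℝ, aeval (![s, ϖ] : Fin 2 → ℝ) N - aeval (![s, u] : Fin 2 → ℝ) N =
        (ϖ - u) * aeval (![s, ϖ, u] : Fin 3 → ℝ) R)
    {s t ϖ : ℝ} (ht : t ≠ 0) (hϖ : 1 - ϖ * t ≠ 0) :
    aeval (![s, ϖ] : Fin 2 → ℝ) N / (1 - ϖ * t) =
      aeval (![s, t⁻¹] : Fin 2 → ℝ) N / (1 - ϖ * t) +
        ∑ d ∈ R.support,
          -(algebraMap ℚ ℝ (R.coeff d) * s ^ (d 0) * t⁻¹ ^ (d 2 + 1)) * ϖ ^ (d 1) := by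
  have h := hR s ϖ t⁻¹
  have ht' : t⁻¹ * t = 1 := inv_mul_cancel₀ ht
  have hsum : ∑ d ∈ R.support,
      -(algebraMap ℚ ℝ (R.coeff d) * s ^ (d 0) * t⁻¹ ^ (d 2 + 1)) * ϖ ^ (d 1) =
        -(t⁻¹ * aeval (![s, ϖ, t⁻¹] : Fin 3 → ℝ) R) := by
    rw [MvPolynomial.aeval_def, MvPolynomial.eval₂_eq', Finset.mul_sum, ← Finset.sum_neg_distrib]
    refine Finset.sum_congr rfl fun d _ => ?_
    rw [Fin.prod_univ_three]
    simp only [Fin.isValue, Matrix.cons_val_zero, Matrix.cons_val_one, Matrix.cons_val_two,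
      Matrix.head_cons, Matrix.tail_cons]
    ring
  rw [hsum, div_add' _ _ _ hϖ, div_left_inj' hϖ]
  linear_combination h - (ϖ * aeval (![s, ϖ, t⁻¹] : Fin 3 → ℝ) R) * ht'

end FaceQuotient

/-- STUB `stub_faceQuotient` (wave 14, algebra + calculus). **The face difference quotient.** For
`τ ∈ ℚ[s]` positive on `[0,1]` and `N ∈ ℚ[s,ϖ]` there is a real polynomial `Pol` with
`∫₀¹ N(s,ϖ)/(1 − ϖτ(s)) ds = ∫₀¹ N(s,1/τ(s))/(1 − ϖτ(s)) ds + Pol(ϖ)` whenever `1 − ϖτ ≠ 0` on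
`[0,1]`: indeed `N(s,ϖ) − N(s,1/τ) = (ϖ − 1/τ)·R` with `R` polynomial in `(s, ϖ, 1/τ)`
(`FaceQuotient.exists_diffQuot`), and `(ϖ − 1/τ)/(1 − ϖτ) = −1/τ` (`FaceQuotient.pointwise`);
integrating the finite sum of continuous coefficient functions against the powers of `ϖ` gives
`Pol`. (The point: the density `N(s,1/τ(s))` no longer depends on `ϖ`.) [folklore] -/
theorem stub_faceQuotient (τ : Polynomial ℚ) (N : MvPolynomial (Fin 2) ℚ)
    (hτ : ∀ s ∈ Icc (0 : ℝ) 1, 0 < Polynomial.aeval s τ) :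
    ∃ Pol : Polynomial ℝ, ∀ ϖ : ℝ, (∀ s ∈ Icc (0 : ℝ) 1, 1 - ϖ * Polynomial.aeval s τ ≠ 0) →
      ∫ s in (0 : ℝ)..1, aeval (![s, ϖ] : Fin 2 → ℝ) N / (1 - ϖ * Polynomial.aeval s τ) =
        (∫ s in (0 : ℝ)..1, aeval (![s, (Polynomial.aeval s τ)⁻¹] : Fin 2 → ℝ) N /
            (1 - ϖ * Polynomial.aeval s τ)) +
          Pol.eval ϖ := by
  obtain ⟨R, hR⟩ := FaceQuotient.exists_diffQuot N
  have hτ0 : ∀ s ∈ Icc (0 : ℝ) 1, Polynomial.aeval s τ ≠ 0 := fun s hs => (hτ s hs).ne'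
  -- the coefficient functions of the correction term
  set g : (Fin 3 →₀ ℕ) → ℝ → ℝ := fun d s =>
    -(algebraMap ℚ ℝ (R.coeff d) * s ^ (d 0) * (Polynomial.aeval s τ)⁻¹ ^ (d 2 + 1)) with hg
  have hgc : ∀ d, ContinuousOn (g d) (Icc (0 : ℝ) 1) := by
    intro d
    simp only [hg]
    fun_prop (disch := exact hτ0)
  have hN : Continuous fun z : Fin 2 → ℝ => aeval z N := FaceQuotient.continuous_aeval N
  refine ⟨∑ d ∈ R.support, Polynomial.C (∫ s in (0 : ℝ)..1, g d s) * Polynomial.X ^ (d 1),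
    fun ϖ hϖ => ?_⟩
  -- the pointwise identity on `[0,1]`
  have hpt : EqOn (fun s => aeval (![s, ϖ] : Fin 2 → ℝ) N / (1 - ϖ * Polynomial.aeval s τ))
      (fun s => aeval (![s, (Polynomial.aeval s τ)⁻¹] : Fin 2 → ℝ) N /
          (1 - ϖ * Polynomial.aeval s τ) + ∑ d ∈ R.support, g d s * ϖ ^ (d 1)) (uIcc 0 1) := by
    intro s hs
    rw [uIcc_of_le zero_le_one] at hs
    exact FaceQuotient.pointwise hR (hτ0 s hs) (hϖ s hs)
  -- integrability of the `ϖ`-independent density and of the correction terms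
  have hf₂ : IntervalIntegrable (fun s => aeval (![s, (Polynomial.aeval s τ)⁻¹] : Fin 2 → ℝ) N /
      (1 - ϖ * Polynomial.aeval s τ)) volume 0 1 := by
    refine ContinuousOn.intervalIntegrable_of_Icc zero_le_one (ContinuousOn.div ?_ ?_ hϖ)
    · refine hN.comp_continuousOn (continuousOn_id.matrixVecCons ?_)
      exact ((Polynomial.continuousOn_aeval τ).inv₀ hτ0).matrixVecCons continuousOn_const
    · fun_prop
  have hgi : ∀ d ∈ R.support, IntervalIntegrable (fun s => g d s * ϖ ^ (d 1)) volume 0 1 :=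
    fun d _ => ContinuousOn.intervalIntegrable_of_Icc zero_le_one ((hgc d).mul continuousOn_const)
  have hsi : IntervalIntegrable (fun s => ∑ d ∈ R.support, g d s * ϖ ^ (d 1)) volume 0 1 :=
    ContinuousOn.intervalIntegrable_of_Icc zero_le_one
      (continuousOn_finsetSum _ fun d _ => (hgc d).mul continuousOn_const)
  rw [intervalIntegral.integral_congr hpt, intervalIntegral.integral_add hf₂ hsi,
    intervalIntegral.integral_finsetSum hgi, Polynomial.eval_finsetSum]
  congr 1
  refine Finset.sum_congr rfl fun d _ => ?_
  rw [intervalIntegral.integral_mul_const, Polynomial.eval_mul, Polynomial.eval_C,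
    Polynomial.eval_pow, Polynomial.eval_X]

end Summit.KontsevichZagierPeriods.InverseLandau.TateFamilyKernel.Descent

end
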